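import Summits.QuantumFields.YangMills.Theorems.UnitScaleTiltProp7TrueLinSourcedOscL1
import Summits.QuantumFields.YangMills.Theorems.UnitScaleTiltProp7LineMeanOsc
import Summits.QuantumFields.YangMills.Theorems.UnitScaleTiltProp7CovCombMeanOscL1
import Summits.QuantumFields.YangMills.Theorems.UnitScaleTiltProp7FibreLogRatioL1
import HarnessLib

/-!
# Route `UnitScaleTilt`, crux K1 «MinimiserStabilityRegPr» (stmt-QuantumFields-19200), route-R [RP] curved, row (n3) N3b, file 2e —
# THE TWO-CHANNEL READING ON THE FIBRE IN LOG CURRENCY: `Σ_c‖Q^{(k)}X(c)‖` bounded, with ALL DAMPED WEIGHTS DISPLAYED, by the `ℓ¹` MASSES `r_j` AND the `ℓ¹`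
# covariant-gradient OSCILLATIONS `s_j` of the one-step remainders in exp-mean-log currency — the concrete instance of the engine ✓∕⧗ `…Prop7TrueLinSourcedOscL1`
# with `hCM` := ★routeR-w2's ✓ `…Prop7CovCombMeanOscL1` and `hLINE` := ✓∕⧗ `…Prop7LineMeanOsc`

Cell `ym3-torus`, D-0154 (3c) extra-width seat `ym-routeR-w6` (gen 3).  THEOREMS ONLY (0 `def`, 0 `sorry`); `--supports stmt-QuantumFields-19200`, count-neutral.  YM₃ on T³ is a
ladder rung (R3), not the Clay problem; nothing here claims the stub, the crux, d = 4 or the mass gap.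

THE POINT (LEAD ★p1 g13 13:42Z–14:22Z).  The undamped log-currency reading ✓ `…Prop7FibreLogRatioL1` charges a smooth chart direction `k·cM∕ℓ`; the cure is the
two-channel engine whose `Λ`-channel reads the covariant comb mean in OSCILLATION currency.  Its two one-level rows are now theorems — (i) ✓ `sum_norm_covCombMean_le_osc`
(`Σ_z‖CM_VZ(z)‖ ≤ c₁·osc_V(Z) + c₂·a′·‖Z‖_{ℓ¹}`, ★routeR-w2) and (ii-a) ✓∕⧗ `osc_line_le` (`osc_{V̄}(LINE_VZ) ≤ L^{2−d}·osc_V(Z) + d·L^{1−d}·(6a + 8L²a′)·‖Z‖_{ℓ¹}`, this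
seat) — both in the SAME oscillation letter `osc_V(Z) = Σ_bΣ_ν‖V(b₋,ν)Z(b+e_ν)V(b₋,ν)* − Z(b)‖` (✓ A2 `sum_normSq_covGrad_le_mass`'s summand).  This file instantiates the
engine at the background tower with that `osc`, the leak weights `w_j = 6a_j + 9L²a′_j` (loop sizes `a_j`, plaquette sizes `a′_j`, both geometric from the top under `RegPr`),
and the log-ratio family of ✓ `…Prop7FibreLogRatioL1` (`X_j = mlog(W̄^{(j)}Ū₀^{(j)*})`, `X_k = 0` on the fibre); what stays DISPLAYED is exactly the per-level SOURCE data of the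
one-step log-remainder `R_j = X_{j+1} − T_jX_j`: its mass `Σ_c‖R_j(c)‖` (damped by `ρ₁^{k−1−j}`, `ρ₁ = L^{1−d}`) and its oscillation `osc_{j+1}(R_j)` (damped by `ρ₂^{·}`,
`ρ₂ = L^{2−d}`) — the objects of ★routeR-w1's word identity ∕ ★p1's `norm_commSum_le_mass_mul_osc` per level; the level sum (c1) is the consumer's.

WHAT IS PROVED (ns `…Theorems.Prop7FibreLogRatioOscL1`; `SU(N)`, any `P`, `k ≤ m + K`).
* §1 `osc_nonneg`, `osc_add_le`, `osc_le_mass` — the covariant-gradient `ℓ¹` sum is a seminorm dominated by `2d·‖·‖_{ℓ¹}` (any background).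
* §2 ★★★ `sum_norm_trueLinIter_le_of_iter_eq_log_osc` — the title (every weight displayed).
HONEST SCOPE.  Bookkeeping only (engine 2d + rows (i), (ii-a) + the fibre reading of 2c); nothing of [Balaban1984PropagatorsI] ∕ [Balaban1985Averaging] is asserted beyond the
cited tree theorems; the per-level source rows and the level sum against a source profile are NOT here.

References: T. Bałaban, CMP 95 (1984) 17–40 [Balaban1984PropagatorsI] ((1.11), (1.18)–(1.20) pp.19–20); CMP 98 (1985) 17–51 [Balaban1985Averaging] ((19)–(23) p.21, Prop. 3
(122)–(126) p.36); CMP 102 (1985) 277–309 [Balaban1985Variational] ((15) p.280, Prop. 7 p.299); CMP 109 (1987) 249–301 [Balaban1987RG1] ((0.3)–(0.4) pp.252–253).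
-/

set_option autoImplicit false

noncomputable section

open scoped BigOperators Matrix.Norms.L2Operator

namespace Summit.QuantumFields.YangMills.Theorems.Prop7FibreLogRatioOscL1

open Literature.MathematicalPhysics.QuantumFieldTheory.Balaban1983to89
open Finset T4Continuum BlockAveraging AveragingRT ExpMeanLog BlockAveragingEMLLinearised BlockAveragingEMLLinearisedBackground BlockAveragingEMLProp2
open MatrixLog (mlog mlog_one)
open Summit.QuantumFields.YangMills.Theorems.Prop7TrueLinSourcedStructure (exists_sourced_reduced_family sub_sourced)
open Summit.QuantumFields.YangMills.Theorems.Prop7TrueLinSourcedOscL1 (sum_norm_sourced_le_osc)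
open Summit.QuantumFields.YangMills.Theorems.Prop7LineMeanOsc (osc_line_le)
open Summit.QuantumFields.YangMills.Theorems.Prop7CovCombMeanOscL1 (sum_norm_covCombMean_le_osc)
open Summit.QuantumFields.YangMills.Theorems.Prop7CurvedLandauRowA (exists_coarseGauge_family)
open Summit.QuantumFields.YangMills.Theorems.Prop7FibreTrueLinDefect (pertVar_self)
open Summit.QuantumFields.YangMills.Theorems.Prop7CovIterLambdaBound (norm_conj_su_le)
open Summit.QuantumFields.YangMills.Theorems.Prop7FlatCoercivity (sum_shift)
open B10StarCount (sum_pbond)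

variable {P : Params} {N : ℕ} [NeZero N]

/-! ## §1 The covariant-gradient `ℓ¹` sum is a seminorm dominated by the mass -/

omit [NeZero N] in
/-- `osc_V(Z) ≥ 0`. [folklore] -/
theorem osc_nonneg {j : ℕ} (V : GaugeField P j (Matrix.specialUnitaryGroup (Fin N) ℂ)) (Z : PBond P j → Matrix (Fin N) (Fin N) ℂ) :
    0 ≤ ∑ b : PBond P j, ∑ ν : Fin P.d, ‖((V ⟨b.src, ν⟩ : Matrix.specialUnitaryGroup (Fin N) ℂ) : Matrix (Fin N) (Fin N) ℂ) * Z ⟨b.src.shift ν, b.dir⟩ * star ((V ⟨b.src, ν⟩ : Matrix.specialUnitaryGroup (Fin N) ℂ) : Matrix (Fin N) (Fin N) ℂ) - Z b‖ :=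
  Finset.sum_nonneg fun _ _ => Finset.sum_nonneg fun _ _ => norm_nonneg _

omit [NeZero N] in
/-- `osc_V(A + B) ≤ osc_V(A) + osc_V(B)`. [folklore] -/
theorem osc_add_le {j : ℕ} (V : GaugeField P j (Matrix.specialUnitaryGroup (Fin N) ℂ)) (A B : PBond P j → Matrix (Fin N) (Fin N) ℂ) :
    ∑ b : PBond P j, ∑ ν : Fin P.d, ‖((V ⟨b.src, ν⟩ : Matrix.specialUnitaryGroup (Fin N) ℂ) : Matrix (Fin N) (Fin N) ℂ) * (A + B) ⟨b.src.shift ν, b.dir⟩ * star ((V ⟨b.src, ν⟩ : Matrix.specialUnitaryGroup (Fin N) ℂ) : Matrix (Fin N) (Fin N) ℂ) - (A + B) b‖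
      ≤ ∑ b : PBond P j, ∑ ν : Fin P.d, ‖((V ⟨b.src, ν⟩ : Matrix.specialUnitaryGroup (Fin N) ℂ) : Matrix (Fin N) (Fin N) ℂ) * A ⟨b.src.shift ν, b.dir⟩ * star ((V ⟨b.src, ν⟩ : Matrix.specialUnitaryGroup (Fin N) ℂ) : Matrix (Fin N) (Fin N) ℂ) - A b‖
        + ∑ b : PBond P j, ∑ ν : Fin P.d, ‖((V ⟨b.src, ν⟩ : Matrix.specialUnitaryGroup (Fin N) ℂ) : Matrix (Fin N) (Fin N) ℂ) * B ⟨b.src.shift ν, b.dir⟩ * star ((V ⟨b.src, ν⟩ : Matrix.specialUnitaryGroup (Fin N) ℂ) : Matrix (Fin N) (Fin N) ℂ) - B b‖ := by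
  rw [← Finset.sum_add_distrib]
  refine Finset.sum_le_sum fun b _ => ?_
  rw [← Finset.sum_add_distrib]
  refine Finset.sum_le_sum fun ν _ => ?_
  have e : ((V ⟨b.src, ν⟩ : Matrix.specialUnitaryGroup (Fin N) ℂ) : Matrix (Fin N) (Fin N) ℂ) * (A + B) ⟨b.src.shift ν, b.dir⟩ * star ((V ⟨b.src, ν⟩ : Matrix.specialUnitaryGroup (Fin N) ℂ) : Matrix (Fin N) (Fin N) ℂ) - (A + B) b
      = (((V ⟨b.src, ν⟩ : Matrix.specialUnitaryGroup (Fin N) ℂ) : Matrix (Fin N) (Fin N) ℂ) * A ⟨b.src.shift ν, b.dir⟩ * star ((V ⟨b.src, ν⟩ : Matrix.specialUnitaryGroup (Fin N) ℂ) : Matrix (Fin N) (Fin N) ℂ) - A b)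
        + (((V ⟨b.src, ν⟩ : Matrix.specialUnitaryGroup (Fin N) ℂ) : Matrix (Fin N) (Fin N) ℂ) * B ⟨b.src.shift ν, b.dir⟩ * star ((V ⟨b.src, ν⟩ : Matrix.specialUnitaryGroup (Fin N) ℂ) : Matrix (Fin N) (Fin N) ℂ) - B b) := by
    simp only [Pi.add_apply]; noncomm_ring
  rw [e]; exact norm_add_le _ _

/-- `osc_V(W) ≤ 2d·Σ_c‖W c‖` (each covariant difference is at most the two norms; the shift is a bijection of the bonds). [folklore] -/
theorem osc_le_mass {j : ℕ} (V : GaugeField P j (Matrix.specialUnitaryGroup (Fin N) ℂ)) (W : PBond P j → Matrix (Fin N) (Fin N) ℂ) :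
    ∑ b : PBond P j, ∑ ν : Fin P.d, ‖((V ⟨b.src, ν⟩ : Matrix.specialUnitaryGroup (Fin N) ℂ) : Matrix (Fin N) (Fin N) ℂ) * W ⟨b.src.shift ν, b.dir⟩ * star ((V ⟨b.src, ν⟩ : Matrix.specialUnitaryGroup (Fin N) ℂ) : Matrix (Fin N) (Fin N) ℂ) - W b‖
      ≤ 2 * (P.d : ℝ) * ∑ b : PBond P j, ‖W b‖ := by
  have hpt : ∀ (b : PBond P j) (ν : Fin P.d), ‖((V ⟨b.src, ν⟩ : Matrix.specialUnitaryGroup (Fin N) ℂ) : Matrix (Fin N) (Fin N) ℂ) * W ⟨b.src.shift ν, b.dir⟩ * star ((V ⟨b.src, ν⟩ : Matrix.specialUnitaryGroup (Fin N) ℂ) : Matrix (Fin N) (Fin N) ℂ) - W b‖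
      ≤ ‖W ⟨b.src.shift ν, b.dir⟩‖ + ‖W b‖ := fun b ν =>
    (norm_sub_le _ _).trans (add_le_add (norm_conj_su_le _ _) le_rfl)
  have hshift : ∀ ν : Fin P.d, ∑ b : PBond P j, ‖W ⟨b.src.shift ν, b.dir⟩‖ = ∑ b : PBond P j, ‖W b‖ := by
    intro ν
    rw [sum_pbond (fun b : PBond P j => ‖W ⟨b.src.shift ν, b.dir⟩‖), sum_pbond (fun b : PBond P j => ‖W b‖)]
    exact sum_shift ν (fun x => ∑ μ : Fin P.d, ‖W ⟨x, μ⟩‖)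
  calc _ ≤ ∑ b : PBond P j, ∑ ν : Fin P.d, (‖W ⟨b.src.shift ν, b.dir⟩‖ + ‖W b‖) :=
        Finset.sum_le_sum fun b _ => Finset.sum_le_sum fun ν _ => hpt b ν
    _ = ∑ b : PBond P j, ∑ ν : Fin P.d, ‖W ⟨b.src.shift ν, b.dir⟩‖ + ∑ b : PBond P j, ∑ _ν : Fin P.d, ‖W b‖ := by
        rw [← Finset.sum_add_distrib]
        exact Finset.sum_congr rfl fun b _ => Finset.sum_add_distrib
    _ = ∑ ν : Fin P.d, ∑ b : PBond P j, ‖W ⟨b.src.shift ν, b.dir⟩‖ + ∑ b : PBond P j, ∑ _ν : Fin P.d, ‖W b‖ := by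
        congr 1
        exact Finset.sum_comm
    _ = (P.d : ℝ) * ∑ b : PBond P j, ‖W b‖ + (P.d : ℝ) * ∑ b : PBond P j, ‖W b‖ := by
        congr 1
        · rw [Finset.sum_congr rfl fun ν _ => hshift ν, Finset.sum_const, Finset.card_univ, Fintype.card_fin, nsmul_eq_mul]
        · rw [Finset.mul_sum]
          exact Finset.sum_congr rfl fun b _ => by rw [Finset.sum_const, Finset.card_univ, Fintype.card_fin, nsmul_eq_mul]
    _ = 2 * (P.d : ℝ) * ∑ b : PBond P j, ‖W b‖ := by ring

/-! ## §2 ★★★ The two-channel reading on the fibre in log currency -/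

/-- ★★★ **THE TWO-CHANNEL READING ON THE FIBRE, LOG CURRENCY, EVERY WEIGHT DISPLAYED.**  `U₀, W ∈ SU(N)` on the finest torus with `W̄^{(k)} = Ū₀^{(k)}` (`k ≤ m + K`);
`Q` the true linearised iterate (`hQ0`, `hQs`); `X` ANY initial field; tower loop sizes `a_j` (`≤ 1/24`, `< δ_N`) and plaquette sizes `a′_j` (level `j < k`); log-ratio
fields `X_j = mlog(pertVar Ū₀^{(j)} W̄^{(j)} + 1)`, one-step log-remainders `R_j = X_{j+1} − T_jX_j`; `osc_j` = the covariant-gradient `ℓ¹` sum at `Ū₀^{(j)}`.  With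
`ρ₁ = (L^d)⁻¹L`, `ρ₂ = (L^d)⁻¹L²`, `κ₁ = 159(d+2)L·2d`, `E_j = exp((κ₁∕ρ₁)Σ_{i<j}a_i)`, `g₀ = Σ_b‖X_0 b − X b‖`, `u_j = ρ₁ʲg₀ + Σ_{l<j}ρ₁^{j−1−l}Σ_c‖R_l(c)‖`,
`w_j = 6a_j + 9L²a′_j`, `c₀ = 2d`, `c₃ = d·ρ₁`, `c₁ = (d+2)L·(d(L−1)/2)`, `c₂ = (d+2)L·(d(L−1)+2)·(dL)²/4`, `t_i = (c₀κ₁a_i + c₃w_i)·(E_i·u_i) + osc_{i+1}(R_i)`: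
`Σ_c‖Q k X c‖ ≤ E_k·u_k + 2d·Σ_{j<k}(c₁·(ρ₂ʲ·osc_0(X_0 − X) + Σ_{i<j}ρ₂^{j−1−i}·t_i) + c₂·w_j·(E_j·u_j))`.
[cite: Balaban1984PropagatorsI, (1.18)-(1.20) pp.19-20; Balaban1985Averaging, (19)-(23) p.21, Prop. 3 (122)-(126) p.36; Balaban1985Variational, Prop. 7 p.299] -/
theorem sum_norm_trueLinIter_le_of_iter_eq_log_osc (U₀ W : GaugeField P 0 (Matrix.specialUnitaryGroup (Fin N) ℂ)) {k : ℕ} (hk : k ≤ P.m + P.K)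
    (hfib : Averaging.iter (fun i => blockAvg (P := P) (j := i) (expMeanLogSU (n := Fin N))) k W = Averaging.iter (fun i => blockAvg (P := P) (j := i) (expMeanLogSU (n := Fin N))) k U₀)
    (Q : (k : ℕ) → (PBond P 0 → Matrix (Fin N) (Fin N) ℂ) → PBond P k → Matrix (Fin N) (Fin N) ℂ) (hQ0 : ∀ Y, Q 0 Y = Y)
    (hQs : ∀ (k : ℕ) (Y : PBond P 0 → Matrix (Fin N) (Fin N) ℂ) (c : PBond P (k + 1)), Q (k + 1) Y c
      = (fderiv ℂ (eml : (Idx P → Matrix (Fin N) (Fin N) ℂ) → Matrix (Fin N) (Fin N) ℂ)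
            (fun i => ((loopHol (Averaging.iter (fun i => blockAvg (P := P) (j := i) (expMeanLogSU (n := Fin N))) k U₀) c i : Matrix.specialUnitaryGroup (Fin N) ℂ) : Matrix (Fin N) (Fin N) ℂ))
            (fun i => covWalkSum (Averaging.iter (fun i => blockAvg (P := P) (j := i) (expMeanLogSU (n := Fin N))) k U₀) (Q k Y) (walk (emb c.src) (loopWord P.L c.dir (off i.1) i.2.1 i.2.2))
              * ((loopHol (Averaging.iter (fun i => blockAvg (P := P) (j := i) (expMeanLogSU (n := Fin N))) k U₀) c i : Matrix.specialUnitaryGroup (Fin N) ℂ) : Matrix (Fin N) (Fin N) ℂ))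
            * star ((corr (expMeanLogSU (n := Fin N)) (Averaging.iter (fun i => blockAvg (P := P) (j := i) (expMeanLogSU (n := Fin N))) k U₀) c : Matrix.specialUnitaryGroup (Fin N) ℂ) : Matrix (Fin N) (Fin N) ℂ)
          + ((corr (expMeanLogSU (n := Fin N)) (Averaging.iter (fun i => blockAvg (P := P) (j := i) (expMeanLogSU (n := Fin N))) k U₀) c : Matrix.specialUnitaryGroup (Fin N) ℂ) : Matrix (Fin N) (Fin N) ℂ)
            * covWalkSum (Averaging.iter (fun i => blockAvg (P := P) (j := i) (expMeanLogSU (n := Fin N))) k U₀) (Q k Y) (walk (emb c.src) (List.replicate P.L (c.dir, true)))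
            * star ((corr (expMeanLogSU (n := Fin N)) (Averaging.iter (fun i => blockAvg (P := P) (j := i) (expMeanLogSU (n := Fin N))) k U₀) c : Matrix.specialUnitaryGroup (Fin N) ℂ) : Matrix (Fin N) (Fin N) ℂ)))
    (X : PBond P 0 → Matrix (Fin N) (Fin N) ℂ)
    (a : ℕ → ℝ) (ha0 : ∀ j, 0 ≤ a j)
    (hα : ∀ j < k, ∀ (c : PBond P (j + 1)) (i : Idx P), dist1 (loopHol (Averaging.iter (fun i => blockAvg (P := P) (j := i) (expMeanLogSU (n := Fin N))) j U₀) c i) ≤ a j)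
    (ha24 : ∀ j < k, a j ≤ 1 / 24) (haN : ∀ j < k, a j < deltaSU (Fin N))
    (a' : ℕ → ℝ) (ha'0 : ∀ j, 0 ≤ a' j)
    (hV : ∀ j < k, ∀ q : Plaq P j, dist1 (GaugeField.plaqHol (Averaging.iter (fun i => blockAvg (P := P) (j := i) (expMeanLogSU (n := Fin N))) j U₀) q) ≤ a' j) :
    ∑ c : PBond P k, ‖Q k X c‖
      ≤ Real.exp ((159 * (((P.d + 2) * P.L : ℕ) : ℝ) * (2 * P.d)) / (((P.L : ℝ) ^ P.d)⁻¹ * (P.L : ℝ)) * ∑ i ∈ Finset.range k, a i) * ((((P.L : ℝ) ^ P.d)⁻¹ * (P.L : ℝ)) ^ k * (∑ b : PBond P 0, ‖mlog (pertVar U₀ W b + 1) - X b‖) + ∑ l ∈ Finset.range k, (((P.L : ℝ) ^ P.d)⁻¹ * (P.L : ℝ)) ^ (k - 1 - l) * ∑ c : PBond P (l + 1), ‖((fun b => mlog (pertVar (Averaging.iter (fun i => blockAvg (P := P) (j := i) (expMeanLogSU (n := Fin N))) (l + 1) U₀) (Averaging.iter (fun i => blockAvg (P := P) (j := i) (expMeanLogSU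 (n := Fin N))) (l + 1) W) b + 1)) c - (fderiv ℂ (eml : (Idx P → Matrix (Fin N) (Fin N) ℂ) → Matrix (Fin N) (Fin N) ℂ)
            (fun i => ((loopHol (Averaging.iter (fun i => blockAvg (P := P) (j := i) (expMeanLogSU (n := Fin N))) l U₀) c i : Matrix.specialUnitaryGroup (Fin N) ℂ) : Matrix (Fin N) (Fin N) ℂ))
            (fun i => covWalkSum (Averaging.iter (fun i => blockAvg (P := P) (j := i) (expMeanLogSU (n := Fin N))) l U₀) (fun b => mlog (pertVar (Averaging.iter (fun i => blockAvg (P := P) (j := i) (expMeanLogSU (n := Fin N))) l U₀) (Averaging.iter (fun i => blockAvg (P := P) (j := i) (expMeanLogSU (n := Fin N))) l W) b + 1)) (walk (emb c.src) (loopWord P.L c.dir (off i.1) i.2.1 i.2.2))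
              * ((loopHol (Averaging.iter (fun i => blockAvg (P := P) (j := i) (expMeanLogSU (n := Fin N))) l U₀) c i : Matrix.specialUnitaryGroup (Fin N) ℂ) : Matrix (Fin N) (Fin N) ℂ))
            * star ((corr (expMeanLogSU (n := Fin N)) (Averaging.iter (fun i => blockAvg (P := P) (j := i) (expMeanLogSU (n := Fin N))) l U₀) c : Matrix.specialUnitaryGroup (Fin N) ℂ) : Matrix (Fin N) (Fin N) ℂ)
          + ((corr (expMeanLogSU (n := Fin N)) (Averaging.iter (fun i => blockAvg (P := P) (j := i) (expMeanLogSU (n := Fin N))) l U₀) c : Matrix.specialUnitaryGroup (Fin N) ℂ) : Matrix (Fin N) (Fin N) ℂ)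
            * covWalkSum (Averaging.iter (fun i => blockAvg (P := P) (j := i) (expMeanLogSU (n := Fin N))) l U₀) (fun b => mlog (pertVar (Averaging.iter (fun i => blockAvg (P := P) (j := i) (expMeanLogSU (n := Fin N))) l U₀) (Averaging.iter (fun i => blockAvg (P := P) (j := i) (expMeanLogSU (n := Fin N))) l W) b + 1)) (walk (emb c.src) (List.replicate P.L (c.dir, true)))
            * star ((corr (expMeanLogSU (n := Fin N)) (Averaging.iter (fun i => blockAvg (P := P) (j := i) (expMeanLogSU (n := Fin N))) l U₀) c : Matrix.specialUnitaryGroup (Fin N) ℂ) : Matrix (Fin N) (Fin N) ℂ)))‖)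
        + 2 * P.d * ∑ j ∈ Finset.range k,
            (((((P.d + 2) * P.L : ℕ) : ℝ) * ((P.d * ((P.L - 1) / 2) : ℕ) : ℝ)) * ((((P.L : ℝ) ^ P.d)⁻¹ * (P.L : ℝ) ^ 2) ^ j * (∑ b : PBond P 0, ∑ ν : Fin P.d, ‖(((Averaging.iter (fun i => blockAvg (P := P) (j := i) (expMeanLogSU (n := Fin N))) 0 U₀) ⟨b.src, ν⟩ : Matrix.specialUnitaryGroup (Fin N) ℂ) : Matrix (Fin N) (Fin N) ℂ) * ((fun b => mlog (pertVar U₀ W b + 1)) - X) ⟨b.src.shift ν, b.dir⟩ * star (((Averaging.iter (fun i => blockAvg (P := P) (j := i) (expMeanLogSU (n := Fin N))) 0 U₀) ⟨b.src, ν⟩ : Matrix.specialUnitaryGroup (Fin N) ℂ) : Matrix (Fin N) (Fin N) ℂ) - ((fun b => mlog (pertVar U₀ W b + 1)) - X) b‖) + ∑ l₁ ∈ Finset.range j, (((P.L : ℝ) ^ P.d)⁻¹ * (P.L : ℝ) ^ 2) ^ (j - 1 - l₁) * (((2 * (P.d : ℝ)) * (159 * (((P.d + 2) * P.L : ℕ)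 : ℝ) * (2 * P.d)) * a l₁ + ((P.d : ℝ) * (((P.L : ℝ) ^ P.d)⁻¹ * (P.L : ℝ))) * (6 * a l₁ + 9 * (P.L : ℝ) ^ 2 * a' l₁)) * (Real.exp ((159 * (((P.d + 2) * P.L : ℕ) : ℝ) * (2 * P.d)) / (((P.L : ℝ) ^ P.d)⁻¹ * (P.L : ℝ)) * ∑ i ∈ Finset.range l₁, a i) * ((((P.L : ℝ) ^ P.d)⁻¹ * (P.L : ℝ)) ^ l₁ * (∑ b : PBond P 0, ‖mlog (pertVar U₀ W b + 1) - X b‖) + ∑ l₂ ∈ Finset.range l₁, (((P.L : ℝ) ^ P.d)⁻¹ * (P.L : ℝ)) ^ (l₁ - 1 - l₂) * ∑ c : PBond P (l₂ + 1), ‖((fun b => mlog (pertVar (Averaging.iter (fun i => blockAvg (P := P) (j := i) (expMeanLogSU (n := Fin N))) (l₂ + 1) U₀) (Averaging.iter (fun i => blockAvg (P := P) (j := i) (expMeanLogSU (n := Fin N))) (l₂ + 1) W) b + 1)) c - (fderiv ℂ (eml : (Idx P → Matrix (Fin N) (Fin N) ℂ) → Matrix (Fin N) (Fin N) ℂ)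
            (fun i => ((loopHol (Averaging.iter (fun i => blockAvg (P := P) (j := i) (expMeanLogSU (n := Fin N))) l₂ U₀) c i : Matrix.specialUnitaryGroup (Fin N) ℂ) : Matrix (Fin N) (Fin N) ℂ))
            (fun i => covWalkSum (Averaging.iter (fun i => blockAvg (P := P) (j := i) (expMeanLogSU (n := Fin N))) l₂ U₀) (fun b => mlog (pertVar (Averaging.iter (fun i => blockAvg (P := P) (j := i) (expMeanLogSU (n := Fin N))) l₂ U₀) (Averaging.iter (fun i => blockAvg (P := P) (j := i) (expMeanLogSU (n := Fin N))) l₂ W) b + 1)) (walk (emb c.src) (loopWord P.L c.dir (off i.1) i.2.1 i.2.2))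
              * ((loopHol (Averaging.iter (fun i => blockAvg (P := P) (j := i) (expMeanLogSU (n := Fin N))) l₂ U₀) c i : Matrix.specialUnitaryGroup (Fin N) ℂ) : Matrix (Fin N) (Fin N) ℂ))
            * star ((corr (expMeanLogSU (n := Fin N)) (Averaging.iter (fun i => blockAvg (P := P) (j := i) (expMeanLogSU (n := Fin N))) l₂ U₀) c : Matrix.specialUnitaryGroup (Fin N) ℂ) : Matrix (Fin N) (Fin N) ℂ)
          + ((corr (expMeanLogSU (n := Fin N)) (Averaging.iter (fun i => blockAvg (P := P) (j := i) (expMeanLogSU (n := Fin N))) l₂ U₀) c : Matrix.specialUnitaryGroup (Fin N) ℂ) : Matrix (Fin N) (Fin N) ℂ)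
            * covWalkSum (Averaging.iter (fun i => blockAvg (P := P) (j := i) (expMeanLogSU (n := Fin N))) l₂ U₀) (fun b => mlog (pertVar (Averaging.iter (fun i => blockAvg (P := P) (j := i) (expMeanLogSU (n := Fin N))) l₂ U₀) (Averaging.iter (fun i => blockAvg (P := P) (j := i) (expMeanLogSU (n := Fin N))) l₂ W) b + 1)) (walk (emb c.src) (List.replicate P.L (c.dir, true)))
            * star ((corr (expMeanLogSU (n := Fin N)) (Averaging.iter (fun i => blockAvg (P := P) (j := i) (expMeanLogSU (n := Fin N))) l₂ U₀) c : Matrix.specialUnitaryGroup (Fin N) ℂ) : Matrix (Fin N) (Fin N) ℂ)))‖)) + (∑ b : PBond P (l₁ + 1), ∑ ν : Fin P.d, ‖(((Averaging.iter (fun i => blockAvg (P := P) (j := i) (expMeanLogSU (n := Fin N))) (l₁ + 1) U₀) ⟨b.src, ν⟩ : Matrix.specialUnitaryGroup (Fin N) ℂ) : Matrix (Fin N) (Fin N) ℂ) * (fun c => (fun b => mlog (pertVar (Averaging.iter (fun i => blockAvg (P := P) (j := i) (expMeanLogSU (n := Fin N))) (l₁ + 1) U₀) (Averaging.iter (fun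 i => blockAvg (P := P) (j := i) (expMeanLogSU (n := Fin N))) (l₁ + 1) W) b + 1)) c - (fderiv ℂ (eml : (Idx P → Matrix (Fin N) (Fin N) ℂ) → Matrix (Fin N) (Fin N) ℂ)
            (fun i => ((loopHol (Averaging.iter (fun i => blockAvg (P := P) (j := i) (expMeanLogSU (n := Fin N))) l₁ U₀) c i : Matrix.specialUnitaryGroup (Fin N) ℂ) : Matrix (Fin N) (Fin N) ℂ))
            (fun i => covWalkSum (Averaging.iter (fun i => blockAvg (P := P) (j := i) (expMeanLogSU (n := Fin N))) l₁ U₀) (fun b => mlog (pertVar (Averaging.iter (fun i => blockAvg (P := P) (j := i) (expMeanLogSU (n := Fin N))) l₁ U₀) (Averaging.iter (fun i => blockAvg (P := P) (j := i) (expMeanLogSU (n := Fin N))) l₁ W) b + 1)) (walk (emb c.src) (loopWord P.L c.dir (off i.1) i.2.1 i.2.2))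
              * ((loopHol (Averaging.iter (fun i => blockAvg (P := P) (j := i) (expMeanLogSU (n := Fin N))) l₁ U₀) c i : Matrix.specialUnitaryGroup (Fin N) ℂ) : Matrix (Fin N) (Fin N) ℂ))
            * star ((corr (expMeanLogSU (n := Fin N)) (Averaging.iter (fun i => blockAvg (P := P) (j := i) (expMeanLogSU (n := Fin N))) l₁ U₀) c : Matrix.specialUnitaryGroup (Fin N) ℂ) : Matrix (Fin N) (Fin N) ℂ)
          + ((corr (expMeanLogSU (n := Fin N)) (Averaging.iter (fun i => blockAvg (P := P) (j := i) (expMeanLogSU (n := Fin N))) l₁ U₀) c : Matrix.specialUnitaryGroup (Fin N) ℂ) : Matrix (Fin N) (Fin N) ℂ)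
            * covWalkSum (Averaging.iter (fun i => blockAvg (P := P) (j := i) (expMeanLogSU (n := Fin N))) l₁ U₀) (fun b => mlog (pertVar (Averaging.iter (fun i => blockAvg (P := P) (j := i) (expMeanLogSU (n := Fin N))) l₁ U₀) (Averaging.iter (fun i => blockAvg (P := P) (j := i) (expMeanLogSU (n := Fin N))) l₁ W) b + 1)) (walk (emb c.src) (List.replicate P.L (c.dir, true)))
            * star ((corr (expMeanLogSU (n := Fin N)) (Averaging.iter (fun i => blockAvg (P := P) (j := i) (expMeanLogSU (n := Fin N))) l₁ U₀) c : Matrix.specialUnitaryGroup (Fin N) ℂ) : Matrix (Fin N) (Fin N) ℂ))) ⟨b.src.shift ν, b.dir⟩ * star (((Averaging.iter (fun i => blockAvg (P := P) (j := i) (expMeanLogSU (n := Fin N))) (l₁ + 1) U₀) ⟨b.src, ν⟩ : Matrix.specialUnitaryGroup (Fin N) ℂ) : Matrix (Fin N) (Fin N) ℂ) - (fun c => (fun b => mlog (pertVar (Averaging.iter (fun i => blockAvg (P := P) (j := i) (expMeanLogSU (n := Fin N))) (l₁ + 1) U₀) (Averaging.iter (fun i => blockAvg (P := P) (j := i) (expMeanLogSU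 (n := Fin N))) (l₁ + 1) W) b + 1)) c - (fderiv ℂ (eml : (Idx P → Matrix (Fin N) (Fin N) ℂ) → Matrix (Fin N) (Fin N) ℂ)
            (fun i => ((loopHol (Averaging.iter (fun i => blockAvg (P := P) (j := i) (expMeanLogSU (n := Fin N))) l₁ U₀) c i : Matrix.specialUnitaryGroup (Fin N) ℂ) : Matrix (Fin N) (Fin N) ℂ))
            (fun i => covWalkSum (Averaging.iter (fun i => blockAvg (P := P) (j := i) (expMeanLogSU (n := Fin N))) l₁ U₀) (fun b => mlog (pertVar (Averaging.iter (fun i => blockAvg (P := P) (j := i) (expMeanLogSU (n := Fin N))) l₁ U₀) (Averaging.iter (fun i => blockAvg (P := P) (j := i) (expMeanLogSU (n := Fin N))) l₁ W) b + 1)) (walk (emb c.src) (loopWord P.L c.dir (off i.1) i.2.1 i.2.2))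
              * ((loopHol (Averaging.iter (fun i => blockAvg (P := P) (j := i) (expMeanLogSU (n := Fin N))) l₁ U₀) c i : Matrix.specialUnitaryGroup (Fin N) ℂ) : Matrix (Fin N) (Fin N) ℂ))
            * star ((corr (expMeanLogSU (n := Fin N)) (Averaging.iter (fun i => blockAvg (P := P) (j := i) (expMeanLogSU (n := Fin N))) l₁ U₀) c : Matrix.specialUnitaryGroup (Fin N) ℂ) : Matrix (Fin N) (Fin N) ℂ)
          + ((corr (expMeanLogSU (n := Fin N)) (Averaging.iter (fun i => blockAvg (P := P) (j := i) (expMeanLogSU (n := Fin N))) l₁ U₀) c : Matrix.specialUnitaryGroup (Fin N) ℂ) : Matrix (Fin N) (Fin N) ℂ)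
            * covWalkSum (Averaging.iter (fun i => blockAvg (P := P) (j := i) (expMeanLogSU (n := Fin N))) l₁ U₀) (fun b => mlog (pertVar (Averaging.iter (fun i => blockAvg (P := P) (j := i) (expMeanLogSU (n := Fin N))) l₁ U₀) (Averaging.iter (fun i => blockAvg (P := P) (j := i) (expMeanLogSU (n := Fin N))) l₁ W) b + 1)) (walk (emb c.src) (List.replicate P.L (c.dir, true)))
            * star ((corr (expMeanLogSU (n := Fin N)) (Averaging.iter (fun i => blockAvg (P := P) (j := i) (expMeanLogSU (n := Fin N))) l₁ U₀) c : Matrix.specialUnitaryGroup (Fin N) ℂ) : Matrix (Fin N) (Fin N) ℂ))) b‖)))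
              + ((((P.d + 2) * P.L : ℕ) : ℝ) * (2 * ((P.d * ((P.L - 1) / 2) : ℕ) : ℝ) + 2) * ((((P.d * P.L : ℕ) : ℝ)) ^ 2 / 4)) * (6 * a j + 9 * (P.L : ℝ) ^ 2 * a' j) * (Real.exp ((159 * (((P.d + 2) * P.L : ℕ) : ℝ) * (2 * P.d)) / (((P.L : ℝ) ^ P.d)⁻¹ * (P.L : ℝ)) * ∑ i ∈ Finset.range j, a i) * ((((P.L : ℝ) ^ P.d)⁻¹ * (P.L : ℝ)) ^ j * (∑ b : PBond P 0, ‖mlog (pertVar U₀ W b + 1) - X b‖) + ∑ l ∈ Finset.range j, (((P.L : ℝ) ^ P.d)⁻¹ * (P.L : ℝ)) ^ (j - 1 - l) * ∑ c : PBond P (l + 1), ‖((fun b => mlog (pertVar (Averaging.iter (fun i => blockAvg (P := P) (j := i) (expMeanLogSU (n := Fin N))) (l + 1) U₀) (Averaging.iter (fun i => blockAvg (P := P) (j := i) (expMeanLogSU (n := Fin N))) (l + 1) W) b + 1)) c - (fderiv ℂ (eml : (Idx P → Matrix (Fin N) (Fin N) ℂ) → Matrix (Fin N) (Fin N) ℂ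)
            (fun i => ((loopHol (Averaging.iter (fun i => blockAvg (P := P) (j := i) (expMeanLogSU (n := Fin N))) l U₀) c i : Matrix.specialUnitaryGroup (Fin N) ℂ) : Matrix (Fin N) (Fin N) ℂ))
            (fun i => covWalkSum (Averaging.iter (fun i => blockAvg (P := P) (j := i) (expMeanLogSU (n := Fin N))) l U₀) (fun b => mlog (pertVar (Averaging.iter (fun i => blockAvg (P := P) (j := i) (expMeanLogSU (n := Fin N))) l U₀) (Averaging.iter (fun i => blockAvg (P := P) (j := i) (expMeanLogSU (n := Fin N))) l W) b + 1)) (walk (emb c.src) (loopWord P.L c.dir (off i.1) i.2.1 i.2.2))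
              * ((loopHol (Averaging.iter (fun i => blockAvg (P := P) (j := i) (expMeanLogSU (n := Fin N))) l U₀) c i : Matrix.specialUnitaryGroup (Fin N) ℂ) : Matrix (Fin N) (Fin N) ℂ))
            * star ((corr (expMeanLogSU (n := Fin N)) (Averaging.iter (fun i => blockAvg (P := P) (j := i) (expMeanLogSU (n := Fin N))) l U₀) c : Matrix.specialUnitaryGroup (Fin N) ℂ) : Matrix (Fin N) (Fin N) ℂ)
          + ((corr (expMeanLogSU (n := Fin N)) (Averaging.iter (fun i => blockAvg (P := P) (j := i) (expMeanLogSU (n := Fin N))) l U₀) c : Matrix.specialUnitaryGroup (Fin N) ℂ) : Matrix (Fin N) (Fin N) ℂ)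
            * covWalkSum (Averaging.iter (fun i => blockAvg (P := P) (j := i) (expMeanLogSU (n := Fin N))) l U₀) (fun b => mlog (pertVar (Averaging.iter (fun i => blockAvg (P := P) (j := i) (expMeanLogSU (n := Fin N))) l U₀) (Averaging.iter (fun i => blockAvg (P := P) (j := i) (expMeanLogSU (n := Fin N))) l W) b + 1)) (walk (emb c.src) (List.replicate P.L (c.dir, true)))
            * star ((corr (expMeanLogSU (n := Fin N)) (Averaging.iter (fun i => blockAvg (P := P) (j := i) (expMeanLogSU (n := Fin N))) l U₀) c : Matrix.specialUnitaryGroup (Fin N) ℂ) : Matrix (Fin N) (Fin N) ℂ)))‖))) := by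
  have hLpos : (0 : ℝ) < (P.L : ℝ) := by exact_mod_cast P.L_pos
  have hL1 : (1 : ℝ) ≤ (P.L : ℝ) := by exact_mod_cast P.L_pos
  -- the sourced family of ✓ 2c and its drive
  have hDs : ∀ (j : ℕ) (c : PBond P (j + 1)), (fun j => (fun b => mlog (pertVar (Averaging.iter (fun i => blockAvg (P := P) (j := i) (expMeanLogSU (n := Fin N))) j U₀) (Averaging.iter (fun i => blockAvg (P := P) (j := i) (expMeanLogSU (n := Fin N))) j W) b + 1)) - Q j X) (j + 1) c
      = (fderiv ℂ (eml : (Idx P → Matrix (Fin N) (Fin N) ℂ) → Matrix (Fin N) (Fin N) ℂ)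
            (fun i => ((loopHol (Averaging.iter (fun i => blockAvg (P := P) (j := i) (expMeanLogSU (n := Fin N))) j U₀) c i : Matrix.specialUnitaryGroup (Fin N) ℂ) : Matrix (Fin N) (Fin N) ℂ))
            (fun i => covWalkSum (Averaging.iter (fun i => blockAvg (P := P) (j := i) (expMeanLogSU (n := Fin N))) j U₀) ((fun j => (fun b => mlog (pertVar (Averaging.iter (fun i => blockAvg (P := P) (j := i) (expMeanLogSU (n := Fin N))) j U₀) (Averaging.iter (fun i => blockAvg (P := P) (j := i) (expMeanLogSU (n := Fin N))) j W) b + 1)) - Q j X) j) (walk (emb c.src) (loopWord P.L c.dir (off i.1) i.2.1 i.2.2))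
              * ((loopHol (Averaging.iter (fun i => blockAvg (P := P) (j := i) (expMeanLogSU (n := Fin N))) j U₀) c i : Matrix.specialUnitaryGroup (Fin N) ℂ) : Matrix (Fin N) (Fin N) ℂ))
            * star ((corr (expMeanLogSU (n := Fin N)) (Averaging.iter (fun i => blockAvg (P := P) (j := i) (expMeanLogSU (n := Fin N))) j U₀) c : Matrix.specialUnitaryGroup (Fin N) ℂ) : Matrix (Fin N) (Fin N) ℂ)
          + ((corr (expMeanLogSU (n := Fin N)) (Averaging.iter (fun i => blockAvg (P := P) (j := i) (expMeanLogSU (n := Fin N))) j U₀) c : Matrix.specialUnitaryGroup (Fin N) ℂ) : Matrix (Fin N) (Fin N) ℂ)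
            * covWalkSum (Averaging.iter (fun i => blockAvg (P := P) (j := i) (expMeanLogSU (n := Fin N))) j U₀) ((fun j => (fun b => mlog (pertVar (Averaging.iter (fun i => blockAvg (P := P) (j := i) (expMeanLogSU (n := Fin N))) j U₀) (Averaging.iter (fun i => blockAvg (P := P) (j := i) (expMeanLogSU (n := Fin N))) j W) b + 1)) - Q j X) j) (walk (emb c.src) (List.replicate P.L (c.dir, true)))
            * star ((corr (expMeanLogSU (n := Fin N)) (Averaging.iter (fun i => blockAvg (P := P) (j := i) (expMeanLogSU (n := Fin N))) j U₀) c : Matrix.specialUnitaryGroup (Fin N) ℂ) : Matrix (Fin N) (Fin N) ℂ)) + (fun j c => ((fun b => mlog (pertVar (Averaging.iter (fun i => blockAvg (P := P) (j := i) (expMeanLogSU (n := Fin N))) (j + 1) U₀) (Averaging.iter (fun i => blockAvg (P := P) (j := i) (expMeanLogSU (n := Fin N))) (j + 1) W) b + 1)) c - (fderiv ℂ (eml : (Idx P → Matrix (Fin N) (Fin N) ℂ) → Matrix (Fin N) (Fin N) ℂ)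
            (fun i => ((loopHol (Averaging.iter (fun i => blockAvg (P := P) (j := i) (expMeanLogSU (n := Fin N))) j U₀) c i : Matrix.specialUnitaryGroup (Fin N) ℂ) : Matrix (Fin N) (Fin N) ℂ))
            (fun i => covWalkSum (Averaging.iter (fun i => blockAvg (P := P) (j := i) (expMeanLogSU (n := Fin N))) j U₀) (fun b => mlog (pertVar (Averaging.iter (fun i => blockAvg (P := P) (j := i) (expMeanLogSU (n := Fin N))) j U₀) (Averaging.iter (fun i => blockAvg (P := P) (j := i) (expMeanLogSU (n := Fin N))) j W) b + 1)) (walk (emb c.src) (loopWord P.L c.dir (off i.1) i.2.1 i.2.2))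
              * ((loopHol (Averaging.iter (fun i => blockAvg (P := P) (j := i) (expMeanLogSU (n := Fin N))) j U₀) c i : Matrix.specialUnitaryGroup (Fin N) ℂ) : Matrix (Fin N) (Fin N) ℂ))
            * star ((corr (expMeanLogSU (n := Fin N)) (Averaging.iter (fun i => blockAvg (P := P) (j := i) (expMeanLogSU (n := Fin N))) j U₀) c : Matrix.specialUnitaryGroup (Fin N) ℂ) : Matrix (Fin N) (Fin N) ℂ)
          + ((corr (expMeanLogSU (n := Fin N)) (Averaging.iter (fun i => blockAvg (P := P) (j := i) (expMeanLogSU (n := Fin N))) j U₀) c : Matrix.specialUnitaryGroup (Fin N) ℂ) : Matrix (Fin N) (Fin N) ℂ)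
            * covWalkSum (Averaging.iter (fun i => blockAvg (P := P) (j := i) (expMeanLogSU (n := Fin N))) j U₀) (fun b => mlog (pertVar (Averaging.iter (fun i => blockAvg (P := P) (j := i) (expMeanLogSU (n := Fin N))) j U₀) (Averaging.iter (fun i => blockAvg (P := P) (j := i) (expMeanLogSU (n := Fin N))) j W) b + 1)) (walk (emb c.src) (List.replicate P.L (c.dir, true)))
            * star ((corr (expMeanLogSU (n := Fin N)) (Averaging.iter (fun i => blockAvg (P := P) (j := i) (expMeanLogSU (n := Fin N))) j U₀) c : Matrix.specialUnitaryGroup (Fin N) ℂ) : Matrix (Fin N) (Fin N) ℂ)))) j c := by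
    intro j c
    exact sub_sourced U₀ (fun j => (fun b => mlog (pertVar (Averaging.iter (fun i => blockAvg (P := P) (j := i) (expMeanLogSU (n := Fin N))) j U₀) (Averaging.iter (fun i => blockAvg (P := P) (j := i) (expMeanLogSU (n := Fin N))) j W) b + 1))) (fun j => Q j X) (fun j c => ((fun b => mlog (pertVar (Averaging.iter (fun i => blockAvg (P := P) (j := i) (expMeanLogSU (n := Fin N))) (j + 1) U₀) (Averaging.iter (fun i => blockAvg (P := P) (j := i) (expMeanLogSU (n := Fin N))) (j + 1) W) b + 1)) c - (fderiv ℂ (eml : (Idx P → Matrix (Fin N) (Fin N) ℂ) → Matrix (Fin N) (Fin N) ℂ)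
            (fun i => ((loopHol (Averaging.iter (fun i => blockAvg (P := P) (j := i) (expMeanLogSU (n := Fin N))) j U₀) c i : Matrix.specialUnitaryGroup (Fin N) ℂ) : Matrix (Fin N) (Fin N) ℂ))
            (fun i => covWalkSum (Averaging.iter (fun i => blockAvg (P := P) (j := i) (expMeanLogSU (n := Fin N))) j U₀) (fun b => mlog (pertVar (Averaging.iter (fun i => blockAvg (P := P) (j := i) (expMeanLogSU (n := Fin N))) j U₀) (Averaging.iter (fun i => blockAvg (P := P) (j := i) (expMeanLogSU (n := Fin N))) j W) b + 1)) (walk (emb c.src) (loopWord P.L c.dir (off i.1) i.2.1 i.2.2))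
              * ((loopHol (Averaging.iter (fun i => blockAvg (P := P) (j := i) (expMeanLogSU (n := Fin N))) j U₀) c i : Matrix.specialUnitaryGroup (Fin N) ℂ) : Matrix (Fin N) (Fin N) ℂ))
            * star ((corr (expMeanLogSU (n := Fin N)) (Averaging.iter (fun i => blockAvg (P := P) (j := i) (expMeanLogSU (n := Fin N))) j U₀) c : Matrix.specialUnitaryGroup (Fin N) ℂ) : Matrix (Fin N) (Fin N) ℂ)
          + ((corr (expMeanLogSU (n := Fin N)) (Averaging.iter (fun i => blockAvg (P := P) (j := i) (expMeanLogSU (n := Fin N))) j U₀) c : Matrix.specialUnitaryGroup (Fin N) ℂ) : Matrix (Fin N) (Fin N) ℂ)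
            * covWalkSum (Averaging.iter (fun i => blockAvg (P := P) (j := i) (expMeanLogSU (n := Fin N))) j U₀) (fun b => mlog (pertVar (Averaging.iter (fun i => blockAvg (P := P) (j := i) (expMeanLogSU (n := Fin N))) j U₀) (Averaging.iter (fun i => blockAvg (P := P) (j := i) (expMeanLogSU (n := Fin N))) j W) b + 1)) (walk (emb c.src) (List.replicate P.L (c.dir, true)))
            * star ((corr (expMeanLogSU (n := Fin N)) (Averaging.iter (fun i => blockAvg (P := P) (j := i) (expMeanLogSU (n := Fin N))) j U₀) c : Matrix.specialUnitaryGroup (Fin N) ℂ) : Matrix (Fin N) (Fin N) ℂ)))) (fun j c => by rw [add_sub_cancel]) (fun j c => hQs j _ c) j c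
  obtain ⟨G, hG0, hGs⟩ := exists_sourced_reduced_family (n := Fin N) U₀ (fun b => mlog (pertVar U₀ W b + 1) - X b) (fun j c => ((fun b => mlog (pertVar (Averaging.iter (fun i => blockAvg (P := P) (j := i) (expMeanLogSU (n := Fin N))) (j + 1) U₀) (Averaging.iter (fun i => blockAvg (P := P) (j := i) (expMeanLogSU (n := Fin N))) (j + 1) W) b + 1)) c - (fderiv ℂ (eml : (Idx P → Matrix (Fin N) (Fin N) ℂ) → Matrix (Fin N) (Fin N) ℂ)
            (fun i => ((loopHol (Averaging.iter (fun i => blockAvg (P := P) (j := i) (expMeanLogSU (n := Fin N))) j U₀) c i : Matrix.specialUnitaryGroup (Fin N) ℂ) : Matrix (Fin N) (Fin N) ℂ))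
            (fun i => covWalkSum (Averaging.iter (fun i => blockAvg (P := P) (j := i) (expMeanLogSU (n := Fin N))) j U₀) (fun b => mlog (pertVar (Averaging.iter (fun i => blockAvg (P := P) (j := i) (expMeanLogSU (n := Fin N))) j U₀) (Averaging.iter (fun i => blockAvg (P := P) (j := i) (expMeanLogSU (n := Fin N))) j W) b + 1)) (walk (emb c.src) (loopWord P.L c.dir (off i.1) i.2.1 i.2.2))
              * ((loopHol (Averaging.iter (fun i => blockAvg (P := P) (j := i) (expMeanLogSU (n := Fin N))) j U₀) c i : Matrix.specialUnitaryGroup (Fin N) ℂ) : Matrix (Fin N) (Fin N) ℂ))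
            * star ((corr (expMeanLogSU (n := Fin N)) (Averaging.iter (fun i => blockAvg (P := P) (j := i) (expMeanLogSU (n := Fin N))) j U₀) c : Matrix.specialUnitaryGroup (Fin N) ℂ) : Matrix (Fin N) (Fin N) ℂ)
          + ((corr (expMeanLogSU (n := Fin N)) (Averaging.iter (fun i => blockAvg (P := P) (j := i) (expMeanLogSU (n := Fin N))) j U₀) c : Matrix.specialUnitaryGroup (Fin N) ℂ) : Matrix (Fin N) (Fin N) ℂ)
            * covWalkSum (Averaging.iter (fun i => blockAvg (P := P) (j := i) (expMeanLogSU (n := Fin N))) j U₀) (fun b => mlog (pertVar (Averaging.iter (fun i => blockAvg (P := P) (j := i) (expMeanLogSU (n := Fin N))) j U₀) (Averaging.iter (fun i => blockAvg (P := P) (j := i) (expMeanLogSU (n := Fin N))) j W) b + 1)) (walk (emb c.src) (List.replicate P.L (c.dir, true)))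
            * star ((corr (expMeanLogSU (n := Fin N)) (Averaging.iter (fun i => blockAvg (P := P) (j := i) (expMeanLogSU (n := Fin N))) j U₀) c : Matrix.specialUnitaryGroup (Fin N) ℂ) : Matrix (Fin N) (Fin N) ℂ))))
  obtain ⟨Λ, hΛ0, hΛs⟩ := exists_coarseGauge_family U₀ G
  have hG0' : ∀ b, G 0 b = (fun j => (fun b => mlog (pertVar (Averaging.iter (fun i => blockAvg (P := P) (j := i) (expMeanLogSU (n := Fin N))) j U₀) (Averaging.iter (fun i => blockAvg (P := P) (j := i) (expMeanLogSU (n := Fin N))) j W) b + 1)) - Q j X) 0 b := by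
    intro b
    rw [hG0]
    simp only [Pi.sub_apply, hQ0]
    rfl
  -- the oscillation functional of record and its three axioms
  have hosc0 : ∀ (j : ℕ) (Z : PBond P j → Matrix (Fin N) (Fin N) ℂ), 0 ≤ (fun (j : ℕ) (Z : PBond P j → Matrix (Fin N) (Fin N) ℂ) => (∑ b : PBond P j, ∑ ν : Fin P.d, ‖(((Averaging.iter (fun i => blockAvg (P := P) (j := i) (expMeanLogSU (n := Fin N))) j U₀) ⟨b.src, ν⟩ : Matrix.specialUnitaryGroup (Fin N) ℂ) : Matrix (Fin N) (Fin N) ℂ) * Z ⟨b.src.shift ν, b.dir⟩ * star (((Averaging.iter (fun i => blockAvg (P := P) (j := i) (expMeanLogSU (n := Fin N))) j U₀) ⟨b.src, ν⟩ : Matrix.specialUnitaryGroup (Fin N) ℂ) : Matrix (Fin N) (Fin N) ℂ) - Z b‖)) j Z := fun j Z => osc_nonneg _ Z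
  have hosc_add : ∀ (j : ℕ) (A B : PBond P j → Matrix (Fin N) (Fin N) ℂ), (fun (j : ℕ) (Z : PBond P j → Matrix (Fin N) (Fin N) ℂ) => (∑ b : PBond P j, ∑ ν : Fin P.d, ‖(((Averaging.iter (fun i => blockAvg (P := P) (j := i) (expMeanLogSU (n := Fin N))) j U₀) ⟨b.src, ν⟩ : Matrix.specialUnitaryGroup (Fin N) ℂ) : Matrix (Fin N) (Fin N) ℂ) * Z ⟨b.src.shift ν, b.dir⟩ * star (((Averaging.iter (fun i => blockAvg (P := P) (j := i) (expMeanLogSU (n := Fin N))) j U₀) ⟨b.src, ν⟩ : Matrix.specialUnitaryGroup (Fin N) ℂ) : Matrix (Fin N) (Fin N) ℂ) - Z b‖)) j (A + B) ≤ (fun (j : ℕ) (Z : PBond P j → Matrix (Fin N) (Fin N) ℂ) => (∑ b : PBond P j, ∑ ν : Fin P.d, ‖(((Averaging.iter (fun i => blockAvg (P := P) (j := i) (expMeanLogSU (n := Fin N))) j U₀) ⟨b.src, ν⟩ : Matrix.specialUnitaryGroup (Fin N) ℂ) : Matrix (Fin N) (Fin N) ℂ) * Z ⟨b.src.shift ν,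 b.dir⟩ * star (((Averaging.iter (fun i => blockAvg (P := P) (j := i) (expMeanLogSU (n := Fin N))) j U₀) ⟨b.src, ν⟩ : Matrix.specialUnitaryGroup (Fin N) ℂ) : Matrix (Fin N) (Fin N) ℂ) - Z b‖)) j A + (fun (j : ℕ) (Z : PBond P j → Matrix (Fin N) (Fin N) ℂ) => (∑ b : PBond P j, ∑ ν : Fin P.d, ‖(((Averaging.iter (fun i => blockAvg (P := P) (j := i) (expMeanLogSU (n := Fin N))) j U₀) ⟨b.src, ν⟩ : Matrix.specialUnitaryGroup (Fin N) ℂ) : Matrix (Fin N) (Fin N) ℂ) * Z ⟨b.src.shift ν, b.dir⟩ * star (((Averaging.iter (fun i => blockAvg (P := P) (j := i) (expMeanLogSU (n := Fin N))) j U₀) ⟨b.src, ν⟩ : Matrix.specialUnitaryGroup (Fin N) ℂ) : Matrix (Fin N) (Fin N) ℂ) - Z b‖)) j B := fun j A B => osc_add_le _ A B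
  have hc₀ : (0 : ℝ) ≤ (2 * (P.d : ℝ)) := by positivity
  have hosc_le : ∀ (j : ℕ) (Wf : PBond P (j + 1) → Matrix (Fin N) (Fin N) ℂ), (fun (j : ℕ) (Z : PBond P j → Matrix (Fin N) (Fin N) ℂ) => (∑ b : PBond P j, ∑ ν : Fin P.d, ‖(((Averaging.iter (fun i => blockAvg (P := P) (j := i) (expMeanLogSU (n := Fin N))) j U₀) ⟨b.src, ν⟩ : Matrix.specialUnitaryGroup (Fin N) ℂ) : Matrix (Fin N) (Fin N) ℂ) * Z ⟨b.src.shift ν, b.dir⟩ * star (((Averaging.iter (fun i => blockAvg (P := P) (j := i) (expMeanLogSU (n := Fin N))) j U₀) ⟨b.src, ν⟩ : Matrix.specialUnitaryGroup (Fin N) ℂ) : Matrix (Fin N) (Fin N) ℂ) - Z b‖)) (j + 1) Wf ≤ (2 * (P.d : ℝ)) * ∑ c : PBond P (j + 1), ‖Wf c‖ := fun j Wf => osc_le_mass _ Wf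
  -- leak weights and constants
  have hw0 : ∀ j, 0 ≤ (6 * a j + 9 * (P.L : ℝ) ^ 2 * a' j) := fun j => by have := ha0 j; have := ha'0 j; positivity
  have hρ₂ : (0 : ℝ) < (((P.L : ℝ) ^ P.d)⁻¹ * (P.L : ℝ) ^ 2) := by positivity
  have hc₁ : (0 : ℝ) ≤ ((((P.d + 2) * P.L : ℕ) : ℝ) * ((P.d * ((P.L - 1) / 2) : ℕ) : ℝ)) := by positivity
  have hc₂ : (0 : ℝ) ≤ ((((P.d + 2) * P.L : ℕ) : ℝ) * (2 * ((P.d * ((P.L - 1) / 2) : ℕ) : ℝ) + 2) * ((((P.d * P.L : ℕ) : ℝ)) ^ 2 / 4)) := by positivity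
  have hc₃ : (0 : ℝ) ≤ ((P.d : ℝ) * (((P.L : ℝ) ^ P.d)⁻¹ * (P.L : ℝ))) := by positivity
  -- (i) the CM-osc row (★routeR-w2)
  have hCM : ∀ j < k, ∀ Z : PBond P j → Matrix (Fin N) (Fin N) ℂ, ∑ z : Site P (j + 1), ‖(((Fintype.card (Idx P) : ℂ))⁻¹ • ∑ i : Idx P,
              covWalkSum (Averaging.iter (fun i => blockAvg (P := P) (j := i) (expMeanLogSU (n := Fin N))) j U₀) Z (walk (emb z) (stairWord i.2.1 (off i.1))))‖ ≤ ((((P.d + 2) * P.L : ℕ) : ℝ) * ((P.d * ((P.L - 1) / 2) : ℕ) : ℝ)) * (fun (j : ℕ) (Z : PBond P j → Matrix (Fin N) (Fin N) ℂ) => (∑ b : PBond P j, ∑ ν : Fin P.d, ‖(((Averaging.iter (fun i => blockAvg (P := P) (j := i) (expMeanLogSU (n := Fin N))) j U₀) ⟨b.src, ν⟩ : Matrix.specialUnitaryGroup (Fin N) ℂ) : Matrix (Fin N) (Fin N) ℂ) * Z ⟨b.src.shift ν, b.dir⟩ * star (((Averaging.iter (fun i => blockAvg (P := P) (j := i) (expMeanLogSU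 (n := Fin N))) j U₀) ⟨b.src, ν⟩ : Matrix.specialUnitaryGroup (Fin N) ℂ) : Matrix (Fin N) (Fin N) ℂ) - Z b‖)) j Z + ((((P.d + 2) * P.L : ℕ) : ℝ) * (2 * ((P.d * ((P.L - 1) / 2) : ℕ) : ℝ) + 2) * ((((P.d * P.L : ℕ) : ℝ)) ^ 2 / 4)) * (6 * a j + 9 * (P.L : ℝ) ^ 2 * a' j) * ∑ b : PBond P j, ‖Z b‖ := by
    intro j hj Z
    have h := sum_norm_covCombMean_le_osc (by omega) (Averaging.iter (fun i => blockAvg (P := P) (j := i) (expMeanLogSU (n := Fin N))) j U₀) (ha'0 j) (hV j hj) Z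
    refine h.trans (add_le_add le_rfl ?_)
    have hmass : 0 ≤ ∑ b : PBond P j, ‖Z b‖ := Finset.sum_nonneg fun b _ => norm_nonneg _
    have hle : a' j ≤ (6 * a j + 9 * (P.L : ℝ) ^ 2 * a' j) := by
      have h1 := ha0 j; have h2 := ha'0 j
      have h4 : a' j ≤ (P.L : ℝ) ^ 2 * a' j := le_mul_of_one_le_left h2 (one_le_pow₀ hL1)
      linarith
    have e : (((P.d + 2) * P.L : ℕ) : ℝ) * (2 * ((P.d * ((P.L - 1) / 2) : ℕ) : ℝ) + 2) * ((((P.d * P.L : ℕ) : ℝ)) ^ 2 / 4 * a' j)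
        = ((((P.d + 2) * P.L : ℕ) : ℝ) * (2 * ((P.d * ((P.L - 1) / 2) : ℕ) : ℝ) + 2) * ((((P.d * P.L : ℕ) : ℝ)) ^ 2 / 4)) * a' j := by ring
    rw [e]
    exact mul_le_mul_of_nonneg_right (mul_le_mul_of_nonneg_left hle hc₂) hmass
  -- (ii-a) the LINE-osc row (this seat)
  have hLINE : ∀ j < k, ∀ Z : PBond P j → Matrix (Fin N) (Fin N) ℂ, (fun (j : ℕ) (Z : PBond P j → Matrix (Fin N) (Fin N) ℂ) => (∑ b : PBond P j, ∑ ν : Fin P.d, ‖(((Averaging.iter (fun i => blockAvg (P := P) (j := i) (expMeanLogSU (n := Fin N))) j U₀) ⟨b.src, ν⟩ : Matrix.specialUnitaryGroup (Fin N) ℂ) : Matrix (Fin N) (Fin N) ℂ) * Z ⟨b.src.shift ν, b.dir⟩ * star (((Averaging.iter (fun i => blockAvg (P := P) (j := i) (expMeanLogSU (n := Fin N))) j U₀) ⟨b.src, ν⟩ : Matrix.specialUnitaryGroup (Fin N) ℂ) : Matrix (Fin N) (Fin N) ℂ) - Z b‖)) (j + 1) (fun c => (((Fintype.card (Idx P)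 : ℂ))⁻¹ • ∑ i : Idx P,
          ((holAt (Averaging.iter (fun i => blockAvg (P := P) (j := i) (expMeanLogSU (n := Fin N))) j U₀) (walk (emb c.src) (stairWord i.2.1 (off i.1))) : Matrix.specialUnitaryGroup (Fin N) ℂ) : Matrix (Fin N) (Fin N) ℂ) *
            covWalkSum (Averaging.iter (fun i => blockAvg (P := P) (j := i) (expMeanLogSU (n := Fin N))) j U₀) Z (walk (walkEnd (emb c.src) (stairWord i.2.1 (off i.1))) (List.replicate P.L (c.dir, true))) *
          star ((holAt (Averaging.iter (fun i => blockAvg (P := P) (j := i) (expMeanLogSU (n := Fin N))) j U₀) (walk (emb c.src) (stairWord i.2.1 (off i.1))) : Matrix.specialUnitaryGroup (Fin N) ℂ) : Matrix (Fin N) (Fin N) ℂ))) ≤ (((P.L : ℝ) ^ P.d)⁻¹ * (P.L : ℝ) ^ 2) * (fun (j : ℕ) (Z : PBond P j → Matrix (Fin N) (Fin N) ℂ) => (∑ b : PBond P j, ∑ ν : Fin P.d, ‖(((Averaging.iter (fun i => blockAvg (P := P) (j := i) (expMeanLogSU (n := Fin N))) j U₀) ⟨b.src, ν⟩ : Matrix.specialUnitaryGroup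 (Fin N) ℂ) : Matrix (Fin N) (Fin N) ℂ) * Z ⟨b.src.shift ν, b.dir⟩ * star (((Averaging.iter (fun i => blockAvg (P := P) (j := i) (expMeanLogSU (n := Fin N))) j U₀) ⟨b.src, ν⟩ : Matrix.specialUnitaryGroup (Fin N) ℂ) : Matrix (Fin N) (Fin N) ℂ) - Z b‖)) j Z + ((P.d : ℝ) * (((P.L : ℝ) ^ P.d)⁻¹ * (P.L : ℝ))) * (6 * a j + 9 * (P.L : ℝ) ^ 2 * a' j) * ∑ b : PBond P j, ‖Z b‖ := by
    intro j hj Z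
    have h := osc_line_le (by omega) (Averaging.iter (fun i => blockAvg (P := P) (j := i) (expMeanLogSU (n := Fin N))) j U₀) Z (ha0 j) (hα j hj) (haN j hj) (by linarith [ha24 j hj]) (ha'0 j) (hV j hj)
    refine h.trans (add_le_add le_rfl ?_)
    have hmass : 0 ≤ ∑ b : PBond P j, ‖Z b‖ := Finset.sum_nonneg fun b _ => norm_nonneg _
    have hle : 6 * a j + 8 * (P.L : ℝ) ^ 2 * a' j ≤ (6 * a j + 9 * (P.L : ℝ) ^ 2 * a' j) := by
      have h3 : 0 ≤ (P.L : ℝ) ^ 2 * a' j := mul_nonneg (sq_nonneg _) (ha'0 j)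
      linarith
    rw [show (P.d : ℝ) * (((P.L : ℝ) ^ P.d)⁻¹ * (P.L : ℝ)) * (6 * a j + 8 * (P.L : ℝ) ^ 2 * a' j) = ((P.d : ℝ) * (((P.L : ℝ) ^ P.d)⁻¹ * (P.L : ℝ))) * (6 * a j + 8 * (P.L : ℝ) ^ 2 * a' j) by ring]
    exact mul_le_mul_of_nonneg_right (mul_le_mul_of_nonneg_left hle hc₃) hmass
  -- the engine
  have hmain := sum_norm_sourced_le_osc U₀ (fun j c => ((fun b => mlog (pertVar (Averaging.iter (fun i => blockAvg (P := P) (j := i) (expMeanLogSU (n := Fin N))) (j + 1) U₀) (Averaging.iter (fun i => blockAvg (P := P) (j := i) (expMeanLogSU (n := Fin N))) (j + 1) W) b + 1)) c - (fderiv ℂ (eml : (Idx P → Matrix (Fin N) (Fin N) ℂ) → Matrix (Fin N) (Fin N) ℂ)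
            (fun i => ((loopHol (Averaging.iter (fun i => blockAvg (P := P) (j := i) (expMeanLogSU (n := Fin N))) j U₀) c i : Matrix.specialUnitaryGroup (Fin N) ℂ) : Matrix (Fin N) (Fin N) ℂ))
            (fun i => covWalkSum (Averaging.iter (fun i => blockAvg (P := P) (j := i) (expMeanLogSU (n := Fin N))) j U₀) (fun b => mlog (pertVar (Averaging.iter (fun i => blockAvg (P := P) (j := i) (expMeanLogSU (n := Fin N))) j U₀) (Averaging.iter (fun i => blockAvg (P := P) (j := i) (expMeanLogSU (n := Fin N))) j W) b + 1)) (walk (emb c.src) (loopWord P.L c.dir (off i.1) i.2.1 i.2.2))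
              * ((loopHol (Averaging.iter (fun i => blockAvg (P := P) (j := i) (expMeanLogSU (n := Fin N))) j U₀) c i : Matrix.specialUnitaryGroup (Fin N) ℂ) : Matrix (Fin N) (Fin N) ℂ))
            * star ((corr (expMeanLogSU (n := Fin N)) (Averaging.iter (fun i => blockAvg (P := P) (j := i) (expMeanLogSU (n := Fin N))) j U₀) c : Matrix.specialUnitaryGroup (Fin N) ℂ) : Matrix (Fin N) (Fin N) ℂ)
          + ((corr (expMeanLogSU (n := Fin N)) (Averaging.iter (fun i => blockAvg (P := P) (j := i) (expMeanLogSU (n := Fin N))) j U₀) c : Matrix.specialUnitaryGroup (Fin N) ℂ) : Matrix (Fin N) (Fin N) ℂ)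
            * covWalkSum (Averaging.iter (fun i => blockAvg (P := P) (j := i) (expMeanLogSU (n := Fin N))) j U₀) (fun b => mlog (pertVar (Averaging.iter (fun i => blockAvg (P := P) (j := i) (expMeanLogSU (n := Fin N))) j U₀) (Averaging.iter (fun i => blockAvg (P := P) (j := i) (expMeanLogSU (n := Fin N))) j W) b + 1)) (walk (emb c.src) (List.replicate P.L (c.dir, true)))
            * star ((corr (expMeanLogSU (n := Fin N)) (Averaging.iter (fun i => blockAvg (P := P) (j := i) (expMeanLogSU (n := Fin N))) j U₀) c : Matrix.specialUnitaryGroup (Fin N) ℂ) : Matrix (Fin N) (Fin N) ℂ)))) (fun j => (fun b => mlog (pertVar (Averaging.iter (fun i => blockAvg (P := P) (j := i) (expMeanLogSU (n := Fin N))) j U₀) (Averaging.iter (fun i => blockAvg (P := P) (j := i) (expMeanLogSU (n := Fin N))) j W) b + 1)) - Q j X) hDs G hG0' hGs Λ hΛ0 hΛs (fun (j : ℕ) (Z : PBond P j → Matrix (Fin N) (Fin N) ℂ) => (∑ b : PBond P j, ∑ ν : Fin P.d, ‖(((Averaging.iter (fun i => blockAvg (P := P) (j := i) (expMeanLogSU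 (n := Fin N))) j U₀) ⟨b.src, ν⟩ : Matrix.specialUnitaryGroup (Fin N) ℂ) : Matrix (Fin N) (Fin N) ℂ) * Z ⟨b.src.shift ν, b.dir⟩ * star (((Averaging.iter (fun i => blockAvg (P := P) (j := i) (expMeanLogSU (n := Fin N))) j U₀) ⟨b.src, ν⟩ : Matrix.specialUnitaryGroup (Fin N) ℂ) : Matrix (Fin N) (Fin N) ℂ) - Z b‖)) hosc0 hosc_add hc₀ hosc_le
    a ha0 hk hα ha24 haN (fun j => (6 * a j + 9 * (P.L : ℝ) ^ 2 * a' j)) hw0 hρ₂ hc₁ hc₂ hc₃ hCM hLINE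
  -- on the fibre `X_k = 0`; at level 0 `Q 0 X = X`
  have hfibre : ∀ c : PBond P k, ‖(fun j => (fun b => mlog (pertVar (Averaging.iter (fun i => blockAvg (P := P) (j := i) (expMeanLogSU (n := Fin N))) j U₀) (Averaging.iter (fun i => blockAvg (P := P) (j := i) (expMeanLogSU (n := Fin N))) j W) b + 1)) - Q j X) k c‖ = ‖Q k X c‖ := by
    intro c
    simp only [Pi.sub_apply]
    rw [hfib, pertVar_self, zero_add, mlog_one, zero_sub, norm_neg]
  have hD0 : ∑ b : PBond P 0, ‖(fun j => (fun b => mlog (pertVar (Averaging.iter (fun i => blockAvg (P := P) (j := i) (expMeanLogSU (n := Fin N))) j U₀) (Averaging.iter (fun i => blockAvg (P := P) (j := i) (expMeanLogSU (n := Fin N))) j W) b + 1)) - Q j X) 0 b‖ = (∑ b : PBond P 0, ‖mlog (pertVar U₀ W b + 1) - X b‖) := by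
    refine Finset.sum_congr rfl fun b _ => ?_
    simp only [Pi.sub_apply, hQ0]
    rfl
  have hO0 : (fun (j : ℕ) (Z : PBond P j → Matrix (Fin N) (Fin N) ℂ) => (∑ b : PBond P j, ∑ ν : Fin P.d, ‖(((Averaging.iter (fun i => blockAvg (P := P) (j := i) (expMeanLogSU (n := Fin N))) j U₀) ⟨b.src, ν⟩ : Matrix.specialUnitaryGroup (Fin N) ℂ) : Matrix (Fin N) (Fin N) ℂ) * Z ⟨b.src.shift ν, b.dir⟩ * star (((Averaging.iter (fun i => blockAvg (P := P) (j := i) (expMeanLogSU (n := Fin N))) j U₀) ⟨b.src, ν⟩ : Matrix.specialUnitaryGroup (Fin N) ℂ) : Matrix (Fin N) (Fin N) ℂ) - Z b‖)) 0 ((fun j => (fun b => mlog (pertVar (Averaging.iter (fun i => blockAvg (P := P) (j := i) (expMeanLogSU (n := Fin N))) j U₀) (Averaging.iter (fun i => blockAvg (P := P) (j := i) (expMeanLogSU (n := Fin N))) j W) b + 1)) - Q j X) 0) = (∑ b : PBond P 0, ∑ ν : Fin P.d, ‖(((Averaging.iter (fun i => blockAvg (P := P) (j := i) (expMeanLogSU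 (n := Fin N))) 0 U₀) ⟨b.src, ν⟩ : Matrix.specialUnitaryGroup (Fin N) ℂ) : Matrix (Fin N) (Fin N) ℂ) * ((fun b => mlog (pertVar U₀ W b + 1)) - X) ⟨b.src.shift ν, b.dir⟩ * star (((Averaging.iter (fun i => blockAvg (P := P) (j := i) (expMeanLogSU (n := Fin N))) 0 U₀) ⟨b.src, ν⟩ : Matrix.specialUnitaryGroup (Fin N) ℂ) : Matrix (Fin N) (Fin N) ℂ) - ((fun b => mlog (pertVar U₀ W b + 1)) - X) b‖) := by
    simp only [Pi.sub_apply, hQ0]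
    rfl
  simp only [hfibre, hD0, hO0] at hmain
  exact hmain

end Summit.QuantumFields.YangMills.Theorems.Prop7FibreLogRatioOscL1

end
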